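import Summits.CriticalPhenomena.CardyFormulaZ2.Theorems.CardyBoundaryCoulombGasRectilinearCardyStubMatching
import Summits.CriticalPhenomena.CardyFormulaZ2.Theorems.CardyBoundaryCoulombGasBoundaryDefectGaussianRStubRealisabilityPart38
import Summits.CriticalPhenomena.CardyFormulaZ2.Theorems.CardyBoundaryCoulombGasRectilinearCardyStubEventIdentityPart5

/-!
# Stub `stub_eventIdentity` of line `excursion-kernel-covariance` (crux `RectilinearCardy`,
# stmt-CriticalPhenomena-5660) — Part 6: the walk of an admissible `(1,1,1; 3)` insertion
# (set-up of the assembly in the design `Lines/excursion-kernel-covariance-eventIdentity-design.md`)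

For leg-insertion data `ι` with three one-leg sources and a three-leg sink (the `(1,3,1,1; 1)`
datum of an injective placement is of this kind), ADMISSIBLE on `V`, with `d₀` the sink's exterior
dart and `e t = (dsucc V)^[t] d₀` the boundary cycle:

* `ei_foldl_one` — after the sink's dart the walk is in state `⟨-2, free, 2 pending, +1⟩`;
* `ei_indices` — **the three sources sit at cycle indices `2 ≤ iA < iB < iC < period`** (distinct
  non-corner vertices met by the walk, `s3_of_admissible`; not at index `1`, where two legs of the
  sink are still pending, by the no-overlap clause of admissibility), each with one outside
  neighbour and its cycle dart as `outDart`;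
* `ei_walk_state` / `ei_inWired1_iff` / `ei_inWired3_iff` — hence the walk states are the block
  states of the matching stub (`sm_walk_state`): free `0` on `(1, iA]`, wired `-1` on `(iA, iB]`,
  free `-2` on `(iB, iC]`, wired `-3` after `iC` and at the start; the level `-1` wired set is the
  vertex block `[iA, iB]`, the level `-3` wired set is `{X} ∪ [iC, period)`;
* `ei_strandEnds` — **the six strand ends, explicitly**: `e_X = ((g_X, K+1), -3)` at the sink's
  dart `(X, K)`, the jump pair `e_v' = ((v, k+3), -2)`, `e_v'' = ((v, k), -1)` at `e 1 = (v, k)`, and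
  the junction ends `e_A = ((g_A, K_A+2), -1)`, `e_B = ((g_B, K_B+1), -2)`, `e_C = ((g_C, K_C+2), -3)`
  at the sources (`g_• = dartTip`), read off `se_mem_strandEnds_iff` with these states.

All [folklore]; no new objects.
-/

namespace Summit.CriticalPhenomena.CardyFormulaZ2.Cruxes.RectilinearCardy.ExcursionKernelCovariance

open Finset Literature.Probability.LatticeModels Literature.Probability.LatticeModels.CollarLegModel
open Summit.CriticalPhenomena.CardyFormulaZ2.Cruxes.BoundaryDefectGaussianR.RainbowMonomialsInExcursionKernels

/-- The image of `{0, 2, 3}` under a placement. [folklore] -/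
theorem ei_image_erase_one (q : Fin 4 → ℤ × ℤ) :
    (Finset.univ.erase (1 : Fin 4)).image q = {q 0, q 2, q 3} := by
  ext x
  simp only [Finset.mem_image, Finset.mem_erase, Finset.mem_univ, and_true, Finset.mem_insert,
    Finset.mem_singleton]
  constructor
  · rintro ⟨a, ha, rfl⟩
    fin_cases a
    · exact Or.inl rfl
    · exact absurd rfl ha
    · exact Or.inr (Or.inl rfl)
    · exact Or.inr (Or.inr rfl)
  · rintro (rfl | rfl | rfl)
    exacts [⟨0, by decide, rfl⟩, ⟨2, by decide, rfl⟩, ⟨3, by decide, rfl⟩]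

/-- Sorting three pairwise distinct naturals. [folklore] -/
theorem ei_sort3 (a b c : ℕ) (hab : a ≠ b) (hbc : b ≠ c) (hac : a ≠ c) :
    ∃ x y z : ℕ, x < y ∧ y < z ∧ ({x, y, z} : Finset ℕ) = {a, b, c} := by
  rcases Nat.lt_or_gt_of_ne hab with h1 | h1 <;> rcases Nat.lt_or_gt_of_ne hbc with h2 | h2 <;>
    rcases Nat.lt_or_gt_of_ne hac with h3 | h3
  · exact ⟨a, b, c, h1, h2, rfl⟩
  · omega
  · exact ⟨a, c, b, h3, h2, by ext; simp; tauto⟩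
  · exact ⟨c, a, b, h3, h1, by ext; simp; tauto⟩
  · exact ⟨b, a, c, h1, h3, by ext; simp; tauto⟩
  · exact ⟨b, c, a, h2, h3, by ext; simp; tauto⟩
  · omega
  · exact ⟨c, b, a, h2, h1, by ext; simp; tauto⟩

section Indices

variable {ι : LegInsertionData} {V : Finset (ℤ × ℤ)} {d₀ : Dart}

/-- **The state after the sink's dart**: for data with `sinkLegs = 3` the walk starts wired at `-3`,
the sink's dart closes the arc (junction to `-2`) and leaves two legs pending. [folklore] -/
theorem ei_foldl_one (hsl : ι.sinkLegs = 3) (h0 : outDart V ι.sink = some d₀) (hP : 1 ≤ period V d₀) :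
    List.foldl (fun s d => s.step (ι.startAt V d)) ι.init ((cycle V d₀).take 1) = ⟨-2, false, 2, 1⟩ := by
  obtain ⟨n, hn⟩ : ∃ n, period V d₀ = n + 1 := ⟨period V d₀ - 1, by omega⟩
  have htake : (cycle V d₀).take 1 = [d₀] := by
    rw [cycle, hn, List.iterate]; rfl
  have hstart : ι.startAt V d₀ = some (3, 1) := by
    unfold LegInsertionData.startAt; rw [if_pos h0, hsl]
  rw [htake, List.foldl_cons, List.foldl_nil, hstart, sm_init hsl]
  rfl

end Indices

/-- **The cycle indices of the three sources.** For ADMISSIBLE data `ι` on `V` whose sources are the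
three points `p 0, p 2, p 3` of an injective placement with sink `p 1` and `sinkLegs = 3`: the sink's
dart `d₀` sits at `X = p 1 ∈ V` pointing out of `V`, and the sources are the vertices of the cycle
darts `e iA, e iB, e iC`, `2 ≤ iA < iB < iC < period`, each a one-outside-neighbour vertex whose
exterior dart is its cycle dart. [folklore] -/
theorem ei_indices {ι : LegInsertionData} {V : Finset (ℤ × ℤ)} {d₀ : Dart} {p : Fin 4 → ℤ × ℤ}
    (hinj : Function.Injective p) (hadm : ι.IsAdmissible V)
    (hsrc : ι.source = (Finset.univ.erase 1).image p) (hsink : ι.sink = p 1) (hsl : ι.sinkLegs = 3)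
    (h0 : outDart V ι.sink = some d₀) :
    d₀.1 = p 1 ∧ d₀.1 ∈ V ∧ dartTip d₀ ∉ V ∧
      ((neighbours d₀.1).filter (fun y => y ∉ V)).card = 1 ∧
    ∃ iA iB iC : ℕ, 2 ≤ iA ∧ iA < iB ∧ iB < iC ∧ iC < period V d₀ ∧
      ι.source = {((dsucc V)^[iA] d₀).1, ((dsucc V)^[iB] d₀).1, ((dsucc V)^[iC] d₀).1} ∧
      (∀ s, s = iA ∨ s = iB ∨ s = iC →
        ((neighbours ((dsucc V)^[s] d₀).1).filter (fun y => y ∉ V)).card = 1 ∧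
        outDart V ((dsucc V)^[s] d₀).1 = some ((dsucc V)^[s] d₀)) := by
  obtain ⟨d₀', h0', hsink', hV, htip, H⟩ := s3_of_admissible ι V hadm
  rw [h0] at h0'
  obtain rfl : d₀ = d₀' := Option.some.inj h0'
  have hcardX : ((neighbours d₀.1).filter (fun y => y ∉ V)).card = 1 := by
    rw [hsink']; exact (H ι.sink (Finset.mem_insert_self _ _)).2.1
  refine ⟨hsink'.trans hsink, hV, htip, hcardX, ?_⟩
  -- the sources and their indices
  have hmem : ∀ i : Fin 4, i ≠ 1 → p i ∈ ι.source := fun i hi => by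
    rw [hsrc]; exact Finset.mem_image_of_mem p (Finset.mem_erase.2 ⟨hi, Finset.mem_univ i⟩)
  have hsrc3 : ι.source = {p 0, p 2, p 3} := by rw [hsrc, ei_image_erase_one]
  choose m hm using fun i : {i : Fin 4 // i ≠ 1} =>
    (H (p i.1) (Finset.mem_insert_of_mem (hmem i.1 i.2))).2.2
  have hcard : ∀ i : {i : Fin 4 // i ≠ 1},
      ((neighbours (p i.1)).filter (fun y => y ∉ V)).card = 1 :=
    fun i => (H (p i.1) (Finset.mem_insert_of_mem (hmem i.1 i.2))).2.1
  have hfst : ∀ i : {i : Fin 4 // i ≠ 1}, ((dsucc V)^[m i] d₀).1 = p i.1 := fun i =>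
    (s3_outDart_some V (p i.1) _ (hm i).2).1
  -- distinct indices, none of them `0`
  have hne : ∀ i j : {i : Fin 4 // i ≠ 1}, m i = m j → i = j := by
    intro i j hij
    have h1 := hfst i
    rw [hij, hfst j] at h1
    exact Subtype.ext (hinj h1.symm)
  have hne0 : ∀ i : {i : Fin 4 // i ≠ 1}, m i ≠ 0 := by
    intro i hi
    have h1 := hfst i
    rw [hi, Function.iterate_zero_apply, hsink'.trans hsink] at h1
    exact i.2 (hinj h1.symm)
  set i0 : {i : Fin 4 // i ≠ 1} := ⟨0, by decide⟩
  set i2 : {i : Fin 4 // i ≠ 1} := ⟨2, by decide⟩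
  set i3 : {i : Fin 4 // i ≠ 1} := ⟨3, by decide⟩
  obtain ⟨iA, iB, iC, hAB, hBC, hperm⟩ := ei_sort3 (m i0) (m i2) (m i3)
    (fun h => by have := hne i0 i2 h; simp [i0, i2] at this)
    (fun h => by have := hne i2 i3 h; simp [i2, i3] at this)
    (fun h => by have := hne i0 i3 h; simp [i0, i3] at this)
  -- membership transfer through the sorted triple
  have hmemT : ∀ s, s = iA ∨ s = iB ∨ s = iC → ∃ i : {i : Fin 4 // i ≠ 1}, m i = s := by
    intro s hs
    have : s ∈ ({iA, iB, iC} : Finset ℕ) := by simp only [Finset.mem_insert, Finset.mem_singleton]; tauto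
    rw [hperm] at this
    simp only [Finset.mem_insert, Finset.mem_singleton] at this
    rcases this with rfl | rfl | rfl
    exacts [⟨i0, rfl⟩, ⟨i2, rfl⟩, ⟨i3, rfl⟩]
  have hprops : ∀ s, s = iA ∨ s = iB ∨ s = iC → s ≠ 0 ∧ s < period V d₀ ∧
      ((neighbours ((dsucc V)^[s] d₀).1).filter (fun y => y ∉ V)).card = 1 ∧
      outDart V ((dsucc V)^[s] d₀).1 = some ((dsucc V)^[s] d₀) := by
    intro s hs
    obtain ⟨i, rfl⟩ := hmemT s hs
    refine ⟨hne0 i, (hm i).1, ?_, ?_⟩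
    · rw [hfst i]; exact hcard i
    · rw [hfst i]; exact (hm i).2
  have hiC : iC < period V d₀ := (hprops iC (Or.inr (Or.inr rfl))).2.1
  -- the source set
  have hsrcE : ι.source = {((dsucc V)^[iA] d₀).1, ((dsucc V)^[iB] d₀).1, ((dsucc V)^[iC] d₀).1} := by
    have himg : ι.source = ({m i0, m i2, m i3} : Finset ℕ).image fun s => ((dsucc V)^[s] d₀).1 := by
      rw [hsrc3, Finset.image_insert, Finset.image_insert, Finset.image_singleton, hfst i0, hfst i2,
        hfst i3]
    rw [himg, ← hperm, Finset.image_insert, Finset.image_insert, Finset.image_singleton]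
  -- `2 ≤ iA`: at index `1` two legs of the sink are pending
  have hiA0 : iA ≠ 0 := (hprops iA (Or.inl rfl)).1
  have hiA1 : iA ≠ 1 := by
    intro h1
    obtain ⟨-, -, -, -, h5, -⟩ := hadm
    have hlen : (cycle V d₀).length = period V d₀ := by simp [cycle]
    have hlt : 1 < (cycle V d₀).length := by rw [hlen]; omega
    have hmemW : ((cycle V d₀)[1], List.foldl (fun s d => s.step (ι.startAt V d)) ι.init ((cycle V d₀).take 1),
        List.foldl (fun s d => s.step (ι.startAt V d)) ι.init ((cycle V d₀).take (1 + 1))) ∈ ι.walk V :=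
      (mem_walk_iff ι V h0).2 ⟨1, hlt, rfl⟩
    have hget : (cycle V d₀)[1] = (dsucc V)^[1] d₀ := by simp [cycle]
    have hsome : ι.startAt V ((cycle V d₀)[1]) ≠ none := by
      rw [hget]
      have hout := (hprops iA (Or.inl rfl)).2.2.2
      rw [h1] at hout
      have hsrc1 : ((dsucc V)^[1] d₀).1 ∈ ι.source := by
        rw [hsrcE, h1]; exact Finset.mem_insert_self _ _
      unfold LegInsertionData.startAt
      by_cases hA : outDart V ι.sink = some ((dsucc V)^[1] d₀)
      · rw [if_pos hA]; simp
      · rw [if_neg hA, if_pos ⟨hsrc1, hout⟩]; simp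
    have hpend := h5 _ hmemW hsome
    simp only at hpend
    rw [ei_foldl_one hsl h0 (by omega)] at hpend
    simp at hpend
  refine ⟨iA, iB, iC, by omega, hAB, hBC, hiC, hsrcE, fun s hs => (hprops s hs).2.2⟩

/-! ### The walk states, the wired sets and the strand ends, by cycle index -/

section Walk

variable {ι : LegInsertionData} {V : Finset (ℤ × ℤ)} {d₀ : Dart} {iA iB iC : ℕ}
  (hv₀ : d₀.1 ∈ V) (ht₀ : dartTip d₀ ∉ V) (hout : outDart V d₀.1 = some d₀)
  (h2 : 2 ≤ iA) (hAB : iA < iB) (hBC : iB < iC) (hCP : iC < period V d₀)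
  (hcA : ((neighbours ((dsucc V)^[iA] d₀).1).filter (fun y ↦ y ∉ V)).card = 1)
  (hcB : ((neighbours ((dsucc V)^[iB] d₀).1).filter (fun y ↦ y ∉ V)).card = 1)
  (hcC : ((neighbours ((dsucc V)^[iC] d₀).1).filter (fun y ↦ y ∉ V)).card = 1)
  (hsrc : ι.source = {((dsucc V)^[iA] d₀).1, ((dsucc V)^[iB] d₀).1, ((dsucc V)^[iC] d₀).1})
  (hlegs : ∀ x ∈ ι.source, ι.legs x = 1) (hsink : ι.sink = d₀.1) (hsl : ι.sinkLegs = 3)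
include hv₀ ht₀ hout h2 hAB hBC hCP hcA hcB hcC hsrc hlegs hsink hsl

omit hv₀ ht₀ hout h2 hAB hBC hCP hcA hcB hcC hlegs hsink hsl in
/-- The sources as the placement `(C, X, A, B)` of the matching stub. [folklore] -/
theorem ei_source_placement :
    ι.source = (Finset.univ.erase 1).image
      ![((dsucc V)^[iC] d₀).1, d₀.1, ((dsucc V)^[iA] d₀).1, ((dsucc V)^[iB] d₀).1] := by
  rw [ei_image_erase_one, hsrc]
  simp only [Matrix.cons_val_zero, Matrix.cons_val]
  ext x; simp only [Finset.mem_insert, Finset.mem_singleton]; tauto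

omit hv₀ ht₀ hout h2 hAB hBC hCP hcA hcB hcC hsink hsl in
/-- One leg at each point of the placement other than the sink. [folklore] -/
theorem ei_legs_placement (i : Fin 4) (hi : i ≠ 1) :
    ι.legs (![((dsucc V)^[iC] d₀).1, d₀.1, ((dsucc V)^[iA] d₀).1, ((dsucc V)^[iB] d₀).1] i) = 1 := by
  apply hlegs
  rw [hsrc]
  fin_cases i
  · simp
  · exact absurd rfl hi
  · simp
  · simp

/-- **The walk states are the block states.** [folklore] -/
theorem ei_walk_state {S : ℕ → WalkState}
    (hS : ∀ t, S t = if t = 0 then ⟨-3, true, 0, 0⟩ else if t = 1 then ⟨-2, false, 2, 1⟩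
      else if t ≤ iA then ⟨0, false, 0, 1⟩ else if t ≤ iB then ⟨-1, true, 0, -1⟩
      else if t ≤ iC then ⟨-2, false, 0, -1⟩ else ⟨-3, true, 0, -1⟩) (t : ℕ) (ht : t ≤ period V d₀) :
    List.foldl (fun s d => s.step (ι.startAt V d)) ι.init ((cycle V d₀).take t) = S t :=
  sm_walk_state hv₀ ht₀ hout hAB hBC hCP hcA hcB hcC rfl
    (ei_source_placement hsrc) (fun i hi => ei_legs_placement hsrc hlegs i hi)
    (by rw [hsink]; rfl) hsl h2 hS t ht

/-- **The level `-1` wired set is the vertex block `[iA, iB]`.** [folklore] -/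
theorem ei_inWired1_iff (x : ℤ × ℤ) :
    (∃ t ∈ ι.walk V, t.1.1 = x ∧
        ((t.2.1.wired = true ∧ t.2.1.level = -1) ∨ (t.2.2.wired = true ∧ t.2.2.level = -1))) ↔
      ∃ s, iA ≤ s ∧ s ≤ iB ∧ ((dsucc V)^[s] d₀).1 = x :=
  sm_inWired1_iff hv₀ ht₀ hout hAB hBC hCP hcA hcB hcC rfl
    (ei_source_placement hsrc) (fun i hi => ei_legs_placement hsrc hlegs i hi)
    (by rw [hsink]; rfl) hsl h2 x

/-- **The level `-3` wired set is `{X} ∪` the vertex block `[iC, period)`.** [folklore] -/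
theorem ei_inWired3_iff (y : ℤ × ℤ) :
    (∃ t ∈ ι.walk V, t.1.1 = y ∧
        ((t.2.1.wired = true ∧ t.2.1.level = -3) ∨ (t.2.2.wired = true ∧ t.2.2.level = -3))) ↔
      y = d₀.1 ∨ ∃ s, iC ≤ s ∧ s < period V d₀ ∧ ((dsucc V)^[s] d₀).1 = y :=
  sm_inWired3_iff hv₀ ht₀ hout hAB hBC hCP hcA hcB hcC rfl
    (ei_source_placement hsrc) (fun i hi => ei_legs_placement hsrc hlegs i hi)
    (by rw [hsink]; rfl) hsl h2 y

/-- **The six strand ends of the `(1,1,1; 3)` insertion, explicitly.** [folklore] -/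
theorem ei_strandEnds :
    ι.strandEnds V =
      {((toSite (dartTip d₀), d₀.2 + 1), -3),
        ((toSite ((dsucc V)^[1] d₀).1, ((dsucc V)^[1] d₀).2 + 3), -2),
        ((toSite ((dsucc V)^[1] d₀).1, ((dsucc V)^[1] d₀).2), -1),
        ((toSite (dartTip ((dsucc V)^[iA] d₀)), ((dsucc V)^[iA] d₀).2 + 2), -1),
        ((toSite (dartTip ((dsucc V)^[iB] d₀)), ((dsucc V)^[iB] d₀).2 + 1), -2),
        ((toSite (dartTip ((dsucc V)^[iC] d₀)), ((dsucc V)^[iC] d₀).2 + 2), -3)} := by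
  obtain ⟨S, hS⟩ : ∃ S : ℕ → WalkState, ∀ t, S t = if t = 0 then ⟨-3, true, 0, 0⟩
      else if t = 1 then ⟨-2, false, 2, 1⟩ else if t ≤ iA then ⟨0, false, 0, 1⟩
      else if t ≤ iB then ⟨-1, true, 0, -1⟩ else if t ≤ iC then ⟨-2, false, 0, -1⟩
      else ⟨-3, true, 0, -1⟩ := ⟨_, fun t => rfl⟩
  have hW := ei_walk_state hv₀ ht₀ hout h2 hAB hBC hCP hcA hcB hcC hsrc hlegs hsink hsl hS
  have h0 : outDart V ι.sink = some d₀ := by rw [hsink]; exact hout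
  have hst : ∀ t, (fun t => List.foldl (fun s d => s.step (ι.startAt V d)) ι.init
      ((cycle V d₀).take t)) t = List.foldl (fun s d => s.step (ι.startAt V d)) ι.init
      ((cycle V d₀).take t) := fun _ => rfl
  have hlen : (cycle V d₀).length = period V d₀ := by simp [cycle]
  have hget : ∀ (t : ℕ) (ht : t < (cycle V d₀).length), (cycle V d₀)[t] = (dsucc V)^[t] d₀ := by
    intro t ht; simp [cycle]
  -- the states at the five active darts and the silence elsewhere
  have hS0 : S 0 = ⟨-3, true, 0, 0⟩ := by rw [hS]; simp
  have hS1 : S 1 = ⟨-2, false, 2, 1⟩ := by rw [hS]; simp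
  have hS2 : S 2 = ⟨0, false, 0, 1⟩ := by rw [hS, if_neg (by omega), if_neg (by omega), if_pos h2]
  have hSA : S iA = ⟨0, false, 0, 1⟩ := by
    rw [hS, if_neg (by omega), if_neg (by omega), if_pos le_rfl]
  have hSA1 : S (iA + 1) = ⟨-1, true, 0, -1⟩ := by
    rw [hS, if_neg (by omega), if_neg (by omega), if_neg (by omega), if_pos (by omega)]
  have hSB : S iB = ⟨-1, true, 0, -1⟩ := by
    rw [hS, if_neg (by omega), if_neg (by omega), if_neg (by omega), if_pos le_rfl]
  have hSB1 : S (iB + 1) = ⟨-2, false, 0, -1⟩ := by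
    rw [hS, if_neg (by omega), if_neg (by omega), if_neg (by omega), if_neg (by omega), if_pos (by omega)]
  have hSC : S iC = ⟨-2, false, 0, -1⟩ := by
    rw [hS, if_neg (by omega), if_neg (by omega), if_neg (by omega), if_neg (by omega), if_pos le_rfl]
  have hSC1 : S (iC + 1) = ⟨-3, true, 0, -1⟩ := by
    rw [hS, if_neg (by omega), if_neg (by omega), if_neg (by omega), if_neg (by omega), if_neg (by omega)]
  have hlevel : ∀ t, (S t).level = if t = 0 then -3 else if t = 1 then -2 else if t ≤ iA then 0
      else if t ≤ iB then -1 else if t ≤ iC then -2 else -3 := by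
    intro t; rw [hS]; split_ifs <;> rfl
  have hsilent : ∀ t, t ≠ 0 → t ≠ 1 → t ≠ iA → t ≠ iB → t ≠ iC → (S (t + 1)).level = (S t).level := by
    intro t h0' h1' hA' hB' hC'
    rw [hlevel t, hlevel (t + 1), if_neg (show t + 1 ≠ 0 by omega), if_neg (show t + 1 ≠ 1 by omega),
      if_neg h0', if_neg h1']
    rcases Nat.lt_or_gt_of_ne hA' with hA | hA
    · rw [if_pos (show t + 1 ≤ iA by omega), if_pos (show t ≤ iA by omega)]
    rw [if_neg (show ¬t + 1 ≤ iA by omega), if_neg (show ¬t ≤ iA by omega)]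
    rcases Nat.lt_or_gt_of_ne hB' with hB | hB
    · rw [if_pos (show t + 1 ≤ iB by omega), if_pos (show t ≤ iB by omega)]
    rw [if_neg (show ¬t + 1 ≤ iB by omega), if_neg (show ¬t ≤ iB by omega)]
    rcases Nat.lt_or_gt_of_ne hC' with hC | hC
    · rw [if_pos (show t + 1 ≤ iC by omega), if_pos (show t ≤ iC by omega)]
    rw [if_neg (show ¬t + 1 ≤ iC by omega), if_neg (show ¬t ≤ iC by omega)]
  ext e
  rw [se_mem_strandEnds_iff ι V h0 hst]
  simp only [Finset.mem_insert, Finset.mem_singleton]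
  constructor
  · rintro ⟨t, ht, he⟩
    rw [hW t (by omega), hW (t + 1) (by omega), hget t ht] at he
    by_cases ht0 : t = 0
    · subst ht0
      rw [hS0, hS1, se_endsAt_junction _ _ _ (by simp) (by simp)] at he
      simp only [ite_true, List.mem_singleton] at he
      left; rw [he]; rfl
    by_cases ht1 : t = 1
    · subst ht1
      rw [hS1, hS2, se_endsAt_jump _ _ _ (by simp)] at he
      simp only [List.mem_cons, List.not_mem_nil, or_false] at he
      rcases he with rfl | rfl
      · right; left; rfl
      · right; right; left; rfl
    by_cases htA : t = iA
    · subst htA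
      rw [hSA, hSA1, se_endsAt_junction _ _ _ (by simp) (by simp)] at he
      simp only [List.mem_singleton, Bool.false_eq_true, ite_false] at he
      right; right; right; left; rw [he]; rfl
    by_cases htB : t = iB
    · subst htB
      rw [hSB, hSB1, se_endsAt_junction _ _ _ (by simp) (by simp)] at he
      simp only [ite_true, List.mem_singleton] at he
      right; right; right; right; left; rw [he]; rfl
    by_cases htC : t = iC
    · subst htC
      rw [hSC, hSC1, se_endsAt_junction _ _ _ (by simp) (by simp)] at he
      simp only [List.mem_singleton, Bool.false_eq_true, ite_false] at he
      right; right; right; right; right; rw [he]; rfl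
    · rw [se_endsAt_nil _ _ _ (hsilent t ht0 ht1 htA htB htC)] at he
      simp at he
  · have hP : ∀ {t : ℕ}, t < period V d₀ → ∃ (ht : t < (cycle V d₀).length),
        LegInsertionData.endsAt ((cycle V d₀)[t], List.foldl (fun s d => s.step (ι.startAt V d)) ι.init
          ((cycle V d₀).take t), List.foldl (fun s d => s.step (ι.startAt V d)) ι.init
          ((cycle V d₀).take (t + 1))) = LegInsertionData.endsAt ((dsucc V)^[t] d₀, S t, S (t + 1)) := by
      intro t ht
      refine ⟨by rw [hlen]; exact ht, ?_⟩
      rw [hW t ht.le, hW (t + 1) (by omega), hget t (by rw [hlen]; exact ht)]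
    rintro (rfl | rfl | rfl | rfl | rfl | rfl)
    · obtain ⟨ht, hEq⟩ := hP (t := 0) (by omega)
      refine ⟨0, ht, ?_⟩
      rw [hEq, hS0, hS1, se_endsAt_junction _ _ _ (by simp) (by simp)]
      simp
    · obtain ⟨ht, hEq⟩ := hP (t := 1) (by omega)
      refine ⟨1, ht, ?_⟩
      rw [hEq, hS1, hS2, se_endsAt_jump _ _ _ (by simp)]
      simp
    · obtain ⟨ht, hEq⟩ := hP (t := 1) (by omega)
      refine ⟨1, ht, ?_⟩
      rw [hEq, hS1, hS2, se_endsAt_jump _ _ _ (by simp)]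
      simp
    · obtain ⟨ht, hEq⟩ := hP (t := iA) (by omega)
      refine ⟨iA, ht, ?_⟩
      rw [hEq, hSA, hSA1, se_endsAt_junction _ _ _ (by simp) (by simp)]
      simp
    · obtain ⟨ht, hEq⟩ := hP (t := iB) (by omega)
      refine ⟨iB, ht, ?_⟩
      rw [hEq, hSB, hSB1, se_endsAt_junction _ _ _ (by simp) (by simp)]
      simp
    · obtain ⟨ht, hEq⟩ := hP (t := iC) hCP
      refine ⟨iC, ht, ?_⟩
      rw [hEq, hSC, hSC1, se_endsAt_junction _ _ _ (by simp) (by simp)]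
      simp

end Walk

end Summit.CriticalPhenomena.CardyFormulaZ2.Cruxes.RectilinearCardy.ExcursionKernelCovariance
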